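import Mathlib
import Summits.AtomisticToContinuum.Crystallization.Theorems.GappedShellCensusFiveFoldRationingRStubFfrC5CorePoles

/-!
# Crux `GappedShellCensus.FiveFoldRationingR` (stmt-AtomisticToContinuum-18071), line `Sketch` —
# stub `stub_ffrC5Core` (the finite core of the capped census),
# file 4/6: the fourth partners of the ring around a pole (registered sub-goal `stub_ffrC5CoreFourth`)

Setting (abstract fan data on the twelve labels `Fin 12`): a family `tri` of `3`-element label sets,
two per side, and a symmetric irreflexive Boolean bond relation with degrees in `{4, 5}`; every bond
is a side of exactly two members of `tri`, every bonded `3`-clique is in `tri`, every member of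
`tri` has a vertex bonded to the other two, every `5`-valent label has only bonded fan triangles and
every `4`-valent label at most two.

This file: fix a pole `w` (a `5`-valent label) with link pentagon `u : Fin 5 → Fin 12`.  Since no
two `5`-valent labels are adjacent, each `u i` is `4`-valent with partners `w, u (i - 1), u (i + 1)`
and exactly one more, the FOURTH PARTNER `x i` (`ffrCC_fourth`); `x i` is none of the `u j` and is
not bonded to `w`, hence is bonded to the other pole `w'`; reading `u i` back off `x i` as a fourth
partner seen from `w'` shows that `x` is injective; consequently `u j ~ x i ↔ j = i`, and the bonded
fan triangles at `u i` are the two at the pole.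
-/

noncomputable section

namespace Summit.AtomisticToContinuum.Crystallization.Theorems

open Finset

section Structure

variable {bond : Fin 12 → Fin 12 → Bool} {tri : Finset (Finset (Fin 12))}
  (bond_symm : ∀ v w, bond v w = bond w v) (bond_irrefl : ∀ v, bond v v = false)
  (bond_deg : ∀ v, 4 ≤ (Finset.univ.filter fun w => bond v w = true).card ∧
    (Finset.univ.filter fun w => bond v w = true).card ≤ 5)
  (tri_card : ∀ S ∈ tri, S.card = 3)
  (two_per_side : ∀ S ∈ tri, ∀ s ⊆ S, s.card = 2 → (tri.filter fun S' => s ⊆ S').card = 2)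
  (bond_side : ∀ v w, bond v w = true →
    (tri.filter fun S' => ({v, w} : Finset (Fin 12)) ⊆ S').card = 2)
  (bond_tri : ∀ a b c, a ≠ b → b ≠ c → a ≠ c → bond a b = true → bond b c = true →
    bond a c = true → ({a, b, c} : Finset (Fin 12)) ∈ tri)
  (two_bond_sides : ∀ S ∈ tri, ∃ a ∈ S, ∀ b ∈ S, b ≠ a → bond a b = true)
  (five_T : ∀ v, (Finset.univ.filter fun w => bond v w = true).card = 5 →
    ∀ S ∈ tri, v ∈ S → ∀ a ∈ S, ∀ b ∈ S, a ≠ b → bond a b = true)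
  (four_T : ∀ v, (Finset.univ.filter fun w => bond v w = true).card = 4 →
    ((tri.filter fun S => v ∈ S).filter
      fun S => ∀ a ∈ S, ∀ b ∈ S, a ≠ b → bond a b = true).card ≤ 2)
variable {w : Fin 12} {u x : Fin 5 → Fin 12}
  (hw : (Finset.univ.filter fun z => bond w z = true).card = 5)
  (hu : Function.Injective u) (hwu : ∀ i, bond w (u i) = true)
  (hcov : ∀ a, bond w a = true → ∃ i, u i = a)
  (hT : ∀ i, ({w, u i, u (i + 1)} : Finset (Fin 12)) ∈ tri)
  (hcl : ∀ S ∈ tri, w ∈ S → ∃ i, S = ({w, u i, u (i + 1)} : Finset (Fin 12)))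
  (hx : ∀ i, bond (u i) (x i) = true ∧ x i ≠ w ∧ x i ≠ u (i - 1) ∧ x i ≠ u (i + 1) ∧
    ∀ z, bond (u i) z = true → z = w ∨ z = u (i - 1) ∨ z = u (i + 1) ∨ z = x i)
  (hD : ∀ v a, (Finset.univ.filter fun z => bond v z = true).card = 5 → bond v a = true →
    (Finset.univ.filter fun z => bond a z = true).card = 4)

include bond_symm bond_irrefl five_T hw hu hwu hT hD in
/-- **The fourth partner.**  With no two adjacent `5`-valent labels, each partner `u i` of the pole
`w` is `4`-valent with partners `w, u (i - 1), u (i + 1)` and exactly one more, `x i`. [folklore] -/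
theorem ffrCC_fourth : ∃ x : Fin 5 → Fin 12, ∀ i, bond (u i) (x i) = true ∧ x i ≠ w ∧
    x i ≠ u (i - 1) ∧ x i ≠ u (i + 1) ∧
    ∀ z, bond (u i) z = true → z = w ∨ z = u (i - 1) ∨ z = u (i + 1) ∨ z = x i := by
  have key : ∀ i, ∃ y : Fin 12, bond (u i) y = true ∧ y ≠ w ∧ y ≠ u (i - 1) ∧ y ≠ u (i + 1) ∧
      ∀ z, bond (u i) z = true → z = w ∨ z = u (i - 1) ∨ z = u (i + 1) ∨ z = y := by
    intro i
    have h4 := hD w (u i) hw (hwu i)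
    have hb_w : bond (u i) w = true := by rw [bond_symm]; exact hwu i
    have e : i - 1 + 1 = i := by omega
    have hb_m : bond (u i) (u (i - 1)) = true := by
      have := (ffrCC_uu five_T hw hu hT (i - 1)).2
      rwa [e] at this
    have hb_p : bond (u i) (u (i + 1)) = true := (ffrCC_uu five_T hw hu hT i).1
    have hKsub : ({w, u (i - 1), u (i + 1)} : Finset (Fin 12)) ⊆
        Finset.univ.filter fun z => bond (u i) z = true := by
      intro k hk
      simp only [Finset.mem_insert, Finset.mem_singleton] at hk
      simp only [Finset.mem_filter, Finset.mem_univ, true_and]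
      rcases hk with h | h | h <;> rw [h]
      exacts [hb_w, hb_m, hb_p]
    have hK3 : ({w, u (i - 1), u (i + 1)} : Finset (Fin 12)).card = 3 :=
      Finset.card_eq_three.2 ⟨w, u (i - 1), u (i + 1),
        (ffrCC_ne_of_bond bond_irrefl (hwu (i - 1))).symm,
        (ffrCC_ne_of_bond bond_irrefl (hwu (i + 1))).symm,
        fun h => by have := hu h; omega, rfl⟩
    have hcard : ((Finset.univ.filter fun z => bond (u i) z = true) \
        {w, u (i - 1), u (i + 1)}).card = 1 := by
      rw [Finset.card_sdiff_of_subset hKsub, h4, hK3]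
    obtain ⟨y, hy⟩ := Finset.card_eq_one.1 hcard
    have hym : y ∈ (Finset.univ.filter fun z => bond (u i) z = true) \
        {w, u (i - 1), u (i + 1)} := by
      rw [hy]; simp
    simp only [Finset.mem_sdiff, Finset.mem_filter, Finset.mem_univ, true_and, Finset.mem_insert,
      Finset.mem_singleton, not_or] at hym
    refine ⟨y, hym.1, hym.2.1, hym.2.2.1, hym.2.2.2, fun z hz => ?_⟩
    by_cases hzK : z ∈ ({w, u (i - 1), u (i + 1)} : Finset (Fin 12))
    · simp only [Finset.mem_insert, Finset.mem_singleton] at hzK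
      rcases hzK with h | h | h
      exacts [Or.inl h, Or.inr (Or.inl h), Or.inr (Or.inr (Or.inl h))]
    · have hzm : z ∈ (Finset.univ.filter fun z => bond (u i) z = true) \
          {w, u (i - 1), u (i + 1)} :=
        Finset.mem_sdiff.2 ⟨by simpa using hz, hzK⟩
      rw [hy, Finset.mem_singleton] at hzm
      exact Or.inr (Or.inr (Or.inr hzm))
  choose y hy using key
  exact ⟨y, hy⟩

include bond_irrefl bond_tri hu hwu hcl hx in
/-- The fourth partners are not partners of the pole. [folklore] -/
theorem ffrCC_x_ne_u (i j : Fin 5) : x i ≠ u j := by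
  intro e
  obtain ⟨hb, -, hm, hp, -⟩ := hx i
  rw [e] at hb hm hp
  rcases ffrCC_chord bond_irrefl bond_tri hu hwu hcl hb with h | h
  · exact hp (by rw [h])
  · exact hm (by rw [h])

include bond_irrefl bond_tri hu hwu hcov hcl hx in
/-- The fourth partners are not bonded to the pole. [folklore] -/
theorem ffrCC_wx (i : Fin 5) : bond w (x i) = false := by
  rcases Bool.eq_false_or_eq_true (bond w (x i)) with h | h
  · obtain ⟨j, hj⟩ := hcov _ h
    exact absurd hj.symm (ffrCC_x_ne_u bond_irrefl bond_tri hu hwu hcl hx i j)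
  · exact h

include bond_symm bond_irrefl tri_card bond_side bond_tri five_T four_T hw hu hwu hcov hcl hx hD in
/-- The fourth partners are bonded to the other pole `w'`. [folklore] -/
theorem ffrCC_w'x {w' : Fin 12} (hww : w ≠ w')
    (hw' : (Finset.univ.filter fun z => bond w' z = true).card = 5)
    (hcovW : ∀ z, z = w ∨ z = w' ∨ bond w z = true ∨ bond w' z = true) (i : Fin 5) :
    bond w' (x i) = true := by
  rcases hcovW (x i) with h | h | h | h
  · exact absurd h (hx i).2.1
  · exfalso
    have hb : bond w' (u i) = true := by rw [← h, bond_symm]; exact (hx i).1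
    exact hww (ffrCC_one5 bond_irrefl tri_card bond_side five_T four_T hD (u i) w w' hw hw'
      (hwu i) hb)
  · rw [ffrCC_wx bond_irrefl bond_tri hu hwu hcov hcl hx] at h
    exact absurd h Bool.false_ne_true
  · exact h

include bond_symm bond_irrefl tri_card bond_side five_T four_T hw hu hwu hx hD in
/-- **The second ring is a ring of five.**  The fourth partners `x i` are pairwise distinct: the
partner `u i` is recovered from `x i` as the fourth partner of `x i` seen from the other pole.
[folklore] -/
theorem ffrCC_x_inj {w' : Fin 12} {u' x' : Fin 5 → Fin 12} (hww : w ≠ w')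
    (hw' : (Finset.univ.filter fun z => bond w' z = true).card = 5)
    (hwu' : ∀ j, bond w' (u' j) = true) (hcov' : ∀ a, bond w' a = true → ∃ j, u' j = a)
    (hx' : ∀ j, bond (u' j) (x' j) = true ∧ x' j ≠ w' ∧ x' j ≠ u' (j - 1) ∧ x' j ≠ u' (j + 1) ∧
      ∀ z, bond (u' j) z = true → z = w' ∨ z = u' (j - 1) ∨ z = u' (j + 1) ∨ z = x' j)
    (hw'x : ∀ i, bond w' (x i) = true) : Function.Injective x := by
  have C : ∀ i j, u' j = x i → u i = x' j := by
    intro i j e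
    have hb : bond (u' j) (u i) = true := by rw [e, bond_symm]; exact (hx i).1
    have two : ∀ k, u i ≠ u' k := by
      intro k hk
      have hb' : bond w' (u i) = true := by rw [hk]; exact hwu' k
      exact hww (ffrCC_one5 bond_irrefl tri_card bond_side five_T four_T hD (u i) w w' hw hw'
        (hwu i) hb')
    rcases (hx' j).2.2.2.2 (u i) hb with h | h | h | h
    · exfalso
      have := hD w (u i) hw (hwu i)
      rw [h] at this
      omega
    · exact absurd h (two _)
    · exact absurd h (two _)
    · exact h
  intro i k e
  obtain ⟨j, hj⟩ := hcov' _ (hw'x i)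
  exact hu ((C i j hj).trans (C k j (hj.trans e)).symm)

include bond_irrefl bond_tri hu hwu hcl hx in
/-- The only partner of `x i` among the `u j` is `u i`. [folklore] -/
theorem ffrCC_ux (hxinj : Function.Injective x) (i j : Fin 5) :
    bond (u j) (x i) = true ↔ j = i := by
  constructor
  · intro h
    rcases (hx j).2.2.2.2 (x i) h with e | e | e | e
    · exact absurd e (hx i).2.1
    · exact absurd e (ffrCC_x_ne_u bond_irrefl bond_tri hu hwu hcl hx i (j - 1))
    · exact absurd e (ffrCC_x_ne_u bond_irrefl bond_tri hu hwu hcl hx i (j + 1))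
    · exact (hxinj e).symm
  · rintro rfl
    exact (hx j).1

include bond_irrefl bond_tri five_T hw hu hwu hT hcl in
/-- Bonds among the partners of the pole are exactly the pentagon sides. [folklore] -/
theorem ffrCC_uu_iff (i j : Fin 5) : bond (u i) (u j) = true ↔ j = i + 1 ∨ j = i - 1 := by
  constructor
  · exact ffrCC_chord bond_irrefl bond_tri hu hwu hcl
  · rintro (e | e)
    · rw [e]; exact (ffrCC_uu five_T hw hu hT i).1
    · rw [e]
      have := (ffrCC_uu five_T hw hu hT (i - 1)).2
      have e1 : i - 1 + 1 = i := by omega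
      rwa [e1] at this

include bond_irrefl five_T four_T hw hu hwu hT hD in
/-- The bonded fan triangles at a partner `u i` of the pole are the two at the pole. [folklore] -/
theorem ffrCC_bonded_at_u (i : Fin 5) (S : Finset (Fin 12)) (hS : S ∈ tri) (hiS : u i ∈ S)
    (hb : ∀ a ∈ S, ∀ b ∈ S, a ≠ b → bond a b = true) :
    S = {w, u (i - 1), u i} ∨ S = {w, u i, u (i + 1)} := by
  by_contra hno
  rw [not_or] at hno
  have e : i - 1 + 1 = i := by omega
  have hTm : ({w, u (i - 1), u i} : Finset (Fin 12)) ∈ tri := by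
    have := hT (i - 1); rwa [e] at this
  have hTmb : ∀ a ∈ ({w, u (i - 1), u i} : Finset (Fin 12)),
      ∀ b ∈ ({w, u (i - 1), u i} : Finset (Fin 12)), a ≠ b → bond a b = true := by
    have := five_T w hw _ (hT (i - 1)) (by simp); rwa [e] at this
  have hne : ({w, u (i - 1), u i} : Finset (Fin 12)) ≠ {w, u i, u (i + 1)} := by
    intro he
    have he' : ({w, u (i - 1), u (i - 1 + 1)} : Finset (Fin 12)) = {w, u i, u (i + 1)} := by
      rw [e]; exact he
    have := ffrCC_T_inj bond_irrefl hu hwu he'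
    omega
  have memF : ∀ S, S ∈ tri → u i ∈ S → (∀ a ∈ S, ∀ b ∈ S, a ≠ b → bond a b = true) →
      S ∈ (tri.filter fun S => u i ∈ S).filter
        fun S => ∀ a ∈ S, ∀ b ∈ S, a ≠ b → bond a b = true := by
    intro S hS hmS hb
    simp only [Finset.mem_filter]
    exact ⟨⟨hS, hmS⟩, hb⟩
  exact ffrCC_absurd_of_card_le_two (four_T (u i) (hD w (u i) hw (hwu i)))
    (memF _ hTm (by simp) hTmb) (memF _ (hT i) (by simp) (five_T w hw _ (hT i) (by simp)))
    (memF S hS hiS hb) hne (Ne.symm hno.1) (Ne.symm hno.2)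

end Structure

/-- **Registered sub-goal `stub_ffrC5CoreFourth` (the fourth partner of a ring label).** [folklore] -/
theorem stub_ffrC5CoreFourth (bond : Fin 12 → Fin 12 → Bool) (tri : Finset (Finset (Fin 12)))
    (bond_symm : ∀ v w, bond v w = bond w v) (bond_irrefl : ∀ v, bond v v = false)
    (five_T : ∀ v, (Finset.univ.filter fun w => bond v w = true).card = 5 →
      ∀ S ∈ tri, v ∈ S → ∀ a ∈ S, ∀ b ∈ S, a ≠ b → bond a b = true)
    (w : Fin 12) (u : Fin 5 → Fin 12) (hw : (Finset.univ.filter fun z => bond w z = true).card = 5)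
    (hu : Function.Injective u) (hwu : ∀ i, bond w (u i) = true)
    (hT : ∀ i, ({w, u i, u (i + 1)} : Finset (Fin 12)) ∈ tri)
    (hD : ∀ v a, (Finset.univ.filter fun z => bond v z = true).card = 5 → bond v a = true →
      (Finset.univ.filter fun z => bond a z = true).card = 4) :
    ∃ x : Fin 5 → Fin 12, ∀ i, bond (u i) (x i) = true ∧ x i ≠ w ∧ x i ≠ u (i - 1) ∧
      x i ≠ u (i + 1) ∧ ∀ z, bond (u i) z = true → z = w ∨ z = u (i - 1) ∨ z = u (i + 1) ∨ z = x i :=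
  ffrCC_fourth bond_symm bond_irrefl five_T hw hu hwu hT hD

end Summit.AtomisticToContinuum.Crystallization.Theorems

end
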